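import Summits.ABC.IUTFork.Repair.RHLinearReachLawMixed
import HarnessLib

/-!
# D-0079 RESCUE sub-cell R-H, row 20′ «tuple reach cell» — `RHLinearReachLawMixedCol`: the per-place-TUPLE column decider of
# `RH.LinearReachLaw.CellReachMixAt` / `HStarReachMix` (Σ₂₀^mix decided from the I06STAR-COLUMNS currency, slot by slot)

PROOF-ONLY file (0 definitions, 0 `Prop` facts; abc-iut cell, rung LADDER-ABC:A2.RESCUE.H; seat abc-iut-rh-typ-7 gen 5, R-H ROUND 2 support hand of the
row-20 lineage; lead abc-iut-rh-lead g2). TAKES NO SIDE on [IUTchIII] Cor. 3.12 or on any author; nothing here asserts abc proved or refuted; the candidate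
`HStarReachMix` (p476752) is a claim-tagged HYPOTHESIS and is never asserted here.

WHY. Gen 4 typed row 20 AT EVERY PRIME (`Repair/RHLinearReachLawMixed.lean` p476752: the rational mixed cell `MixedReachCell α β j μ` of ONE summand, slots at
possibly different places over `p`; `CellReachMixAt X p i ev`; `HStarReachMix X`) and its door through to the hSHw body / ABC (p477348, p477961). Two numerics
seats now evaluate Σ₂₀^mix on the tables (abc-iut-rh2-q3-num `Q3-SIGMA20MIX-v1.tsv` 9cd6aba8fb968dbf: 0 failing mixes among the 1,716 all-diagonal-POS multi-type
fibres of the v7 bed; abc-iut-rh-kit-1 PASS 13) by reading EACH SLOT's inner conductor / outer order off the columns `r_in_ub = ⌊e/(p−1)⌋ + 1`,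
`r_out_sharp = p^{a₀} − e·a₀`. This file is the kernel statement they compute against — the tuple twin of `cellReachAt_iff_col_of_not_dvd` (p465403) /
`cellReachAt_pilotDataOfK_iff_col_of_not_dvd` (p470484 §3):

* §C1 `mixedReachCell_mono_cert` (larger inner exponents `α` and smaller outer exponents `β` only HELP the rational cell — same total level `K`);
  `mixedReachCell_of_one_le_width` (an admissible `K`-interval of length `≥ 1` contains an integer: the NON-boundary-layer criterion of the numerics recipe).
* §C2 at any pilot datum `X`: `not_cellReachMixAt_of_not_col` — COLUMN-NEG ⇒ NEG for EVERY slot tuple (every `p`, every `e_a`; inner ties `(p−1) ∣ e_a`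
  included: `isInnerConductor_le` / `le_of_isOuterOrder` are unconditional); `cellReachMixAt_iff_col_of_not_dvd` — if EVERY slot is untied (`(p−1) ∤ e_a`,
  strict turning point `a₀ a`) the column evaluation DECIDES the mixed cell (`isInnerConductor_of_not_dvd` / `isOuterOrder_envelope` per slot, then
  `cellReachMixAt_iff_of_certs`); `not_hStarReachMix_of_not_cellReachMixAt`.
* §C3 at the genuine bed `X := Cor312Prov.pilotDataOfK D K`: `cellReachMixAt_pilotDataOfK_iff_col_of_not_dvd` and `not_hStarReachMix_pilotDataOfK_of_not_col`,
  with the last slot's depth rewritten `ord_x(q) = e(x|v)·ord_v(q_v)` (`Cor312Prov.ordq_pilotDataOfK`, [IUTchI] Def. 3.1 (c)) and `l` the datum's `l`.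
Reading for the tables: per slot `a` the exponents are `α_a = (r_in_ub(e_a) − 1)/e_a`, `β_a = r_out_sharp(e_a)/e_a`, `μ = ord_last(q)/(2l·e_last)`; a summand
is POS iff `⌈j²μ − Σ_a(1 + α_a)⌉ ≤ ⌊μ − Σ_a β_a⌋` (`mixedReachCell_iff_ceil_le_floor`), EXACT at all-untied tuples, NEG-side only when a slot is tied.
[cite: Mochizuki2012, IUTchI Def. 3.1 (c) p. 61; IUTchIII Thm. 3.11 (i) (Ind2) p. 154] [cite: NeukirchANT1999, Ch. II (5.5)]
[claim: Mochizuki2012, status: disputed] for every IUT sentence quoted. 0 sorry; standard axioms.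
-/

noncomputable section

open Set Metric Function NumberField IsDedekindDomain
open scoped Pointwise

namespace Summit.ABC.IUTFork.Repair.RH.LinearReachLaw

open Literature.IUT.LogVolume Literature.NumberTheory.GaloisRepresentations.Ultrametric

/-! ## §C1. Arithmetic of the rational mixed cell: certificate monotonicity and the width criterion -/

/-- **Monotonicity in the certificates** (tuple form of `reachCell2l_mono_cert`): slot-wise LARGER inner exponents `α ≤ α'` and SMALLER outer exponents
`β' ≤ β` only help the mixed cell — the same total level `K` works. [folklore] -/
theorem mixedReachCell_mono_cert {ι : Type*} [Fintype ι] {α α' β β' : ι → ℚ} {j : ℕ} {μ : ℚ}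
    (hα : ∀ a, α a ≤ α' a) (hβ : ∀ a, β' a ≤ β a) (h : MixedReachCell α β j μ) : MixedReachCell α' β' j μ := by
  obtain ⟨K, h1, h2⟩ := h
  have hs1 : ∑ a, (1 + α a) ≤ ∑ a, (1 + α' a) := Finset.sum_le_sum fun a _ => by linarith [hα a]
  have hs2 : ∑ a, β' a ≤ ∑ a, β a := Finset.sum_le_sum fun a _ => hβ a
  exact ⟨K, h1.trans (by linarith), le_trans (by linarith) h2⟩

/-- **Width criterion** (the non-boundary-layer case of the numerics recipe): if the admissible `K`-interval
`[j²μ − Σ_a(1 + α_a), μ − Σ_a β_a]` has length `≥ 1` it contains an integer, so the mixed cell HOLDS. [folklore] -/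
theorem mixedReachCell_of_one_le_width {ι : Type*} [Fintype ι] {α β : ι → ℚ} {j : ℕ} {μ : ℚ}
    (h : 1 ≤ (μ - ∑ a, β a) - ((j : ℚ) ^ 2 * μ - ∑ a, (1 + α a))) : MixedReachCell α β j μ := by
  rw [mixedReachCell_iff_ceil_le_floor]
  have h1 := Int.ceil_lt_add_one ((j : ℚ) ^ 2 * μ - ∑ a, (1 + α a))
  exact Int.le_floor.2 (by linarith)

/-! ## §C2. The column decider of the mixed cell at a pilot datum (slot by slot) -/

section Candidate

open Literature.IUT.LogThetaLattice Thm311 Thm311.Real Cor312 Cor312.Setting Cor312Vol Cor312Prov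
  Summit.ABC.IUTFork.Repair.RH.ShellCapacityPlus

variable {F : Type} [Field F] [NumberField F] (X : PilotData F)

/-- **COLUMN-NEG ⇒ NEG of the mixed cell, unconditionally** (every `p`, every slot ramification `e_a`; tie slots included): if the rational cell FAILS at the
column values `c_a := ⌊e_a/(p−1)⌋ + 1 = r_in_ub(e_a)`, `B_a := p^{a₀ a} − e_a·(a₀ a) = r_out_sharp(e_a)` (`a₀ a` any turning point of `e_a`), then
`CellReachMixAt X p i ev` fails — because THE inner conductor of each slot is `≤ r_in_ub` (`isInnerConductor_le`) and THE outer order is `≥ r_out_sharp`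
(`le_of_isOuterOrder`), and the cell is monotone in both (`mixedReachCell_mono_cert`). [cite: NeukirchANT1999, Ch. II (5.5)]
[claim: Mochizuki2012, status: disputed] -/
theorem not_cellReachMixAt_of_not_col (pp : Nat.Primes) [Fact (pp : ℕ).Prime] (i : Fin X.lstar)
    (ev : (thetaIndex X).Caps (Setting.labelSucc i) → (thetaIndex X).Fibre (.inr pp))
    {a₀ : (thetaIndex X).Caps (Setting.labelSucc i) → ℕ}
    (hlo : ∀ a, ∀ t < a₀ a, ((pp : ℕ) : ℤ) ^ t * (((pp : ℕ) : ℤ) - 1) < (placeOf X pp.1 (ev a)).asIdeal.ramificationIdx ℤ)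
    (hhi : ∀ a, ((placeOf X pp.1 (ev a)).asIdeal.ramificationIdx ℤ : ℤ) ≤ ((pp : ℕ) : ℤ) ^ (a₀ a) * (((pp : ℕ) : ℤ) - 1))
    (hneg : ¬ MixedReachCell
      (fun a => ((((placeOf X pp.1 (ev a)).asIdeal.ramificationIdx ℤ / ((pp : ℕ) - 1) + 1 : ℕ) : ℚ) - 1) /
        ((placeOf X pp.1 (ev a)).asIdeal.ramificationIdx ℤ : ℚ))
      (fun a => ((((pp : ℕ) : ℤ) ^ (a₀ a) - ((placeOf X pp.1 (ev a)).asIdeal.ramificationIdx ℤ : ℤ) * (a₀ a : ℤ) : ℤ) : ℚ) /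
        ((placeOf X pp.1 (ev a)).asIdeal.ramificationIdx ℤ : ℚ)) ((i : ℕ) + 1)
      ((X.ordq (placeOf X pp.1 (ev (Fin.last _))) : ℚ) /
        (2 * X.l * ((placeOf X pp.1 (ev (Fin.last _))).asIdeal.ramificationIdx ℤ : ℚ)))) :
    ¬ CellReachMixAt X pp i ev := by
  intro h
  have hϖ : ∀ a, IsUniformizer (unifChoice (kOf X pp.1 (ev a))) := fun a => isUniformizer_unifChoice _
  -- THE lattice integers of every slot, and their column bounds
  choose c hc using fun a => exists_isInnerConductor (pp : ℕ) (hϖ a)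
  choose B hB using fun a => exists_isOuterOrder (pp : ℕ) (hϖ a)
  have hcle : ∀ a, c a ≤ (placeOf X pp.1 (ev a)).asIdeal.ramificationIdx ℤ / ((pp : ℕ) - 1) + 1 := fun a => by
    have h1 := isInnerConductor_le (pp : ℕ) (hϖ a) (hc a)
    rwa [absRamificationIdx_kOf X pp (ev a)] at h1
  have hBge : ∀ a, ((pp : ℕ) : ℤ) ^ (a₀ a) - ((placeOf X pp.1 (ev a)).asIdeal.ramificationIdx ℤ : ℤ) * (a₀ a : ℤ) ≤ B a := fun a => by
    have he := absRamificationIdx_kOf X pp (ev a)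
    have h1 := le_of_isOuterOrder (pp : ℕ) (hϖ a) (hB a) (a₀ := a₀ a) (by rw [he]; exact hlo a) (by rw [he]; exact hhi a)
    rwa [he] at h1
  have hcell := h (fun a => unifChoice (kOf X pp.1 (ev a))) hϖ c B hc hB
  refine hneg (mixedReachCell_mono_cert (fun a => ?_) (fun a => ?_) hcell)
  · have he : (0 : ℚ) < ((placeOf X pp.1 (ev a)).asIdeal.ramificationIdx ℤ : ℚ) := by
      exact_mod_cast Ideal.ramificationIdx_pos _ _
    have h1 : (c a : ℚ) ≤ (((placeOf X pp.1 (ev a)).asIdeal.ramificationIdx ℤ / ((pp : ℕ) - 1) + 1 : ℕ) : ℚ) := by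
      exact_mod_cast hcle a
    exact div_le_div_of_nonneg_right (by linarith) he.le
  · have he : (0 : ℚ) < ((placeOf X pp.1 (ev a)).asIdeal.ramificationIdx ℤ : ℚ) := by
      exact_mod_cast Ideal.ramificationIdx_pos _ _
    exact div_le_div_of_nonneg_right (by exact_mod_cast hBge a) he.le

/-- **COLUMN CELL ⟺ MIXED CELL when EVERY slot is untied** (`(p−1) ∤ e_a`, strict turning point `a₀ a` at each slot `a`): then each slot's inner conductor
IS `r_in_ub(e_a)` (`isInnerConductor_of_not_dvd`) and its outer order IS `r_out_sharp(e_a)` (`isOuterOrder_envelope`), so the column evaluation DECIDES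
`CellReachMixAt X p i ev` at every datum with these slot types. [cite: NeukirchANT1999, Ch. II (5.5)] [claim: Mochizuki2012, status: disputed] -/
theorem cellReachMixAt_iff_col_of_not_dvd (pp : Nat.Primes) [Fact (pp : ℕ).Prime] (i : Fin X.lstar)
    (ev : (thetaIndex X).Caps (Setting.labelSucc i) → (thetaIndex X).Fibre (.inr pp))
    (hnd : ∀ a, ¬ ((pp : ℕ) - 1 ∣ (placeOf X pp.1 (ev a)).asIdeal.ramificationIdx ℤ))
    {a₀ : (thetaIndex X).Caps (Setting.labelSucc i) → ℕ}
    (hlo : ∀ a, ∀ t < a₀ a, ((pp : ℕ) : ℤ) ^ t * (((pp : ℕ) : ℤ) - 1) < (placeOf X pp.1 (ev a)).asIdeal.ramificationIdx ℤ)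
    (hhi : ∀ a, ((placeOf X pp.1 (ev a)).asIdeal.ramificationIdx ℤ : ℤ) < ((pp : ℕ) : ℤ) ^ (a₀ a) * (((pp : ℕ) : ℤ) - 1)) :
    CellReachMixAt X pp i ev ↔
      MixedReachCell
        (fun a => ((((placeOf X pp.1 (ev a)).asIdeal.ramificationIdx ℤ / ((pp : ℕ) - 1) + 1 : ℕ) : ℚ) - 1) /
          ((placeOf X pp.1 (ev a)).asIdeal.ramificationIdx ℤ : ℚ))
        (fun a => ((((pp : ℕ) : ℤ) ^ (a₀ a) - ((placeOf X pp.1 (ev a)).asIdeal.ramificationIdx ℤ : ℤ) * (a₀ a : ℤ) : ℤ) : ℚ) /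
          ((placeOf X pp.1 (ev a)).asIdeal.ramificationIdx ℤ : ℚ)) ((i : ℕ) + 1)
        ((X.ordq (placeOf X pp.1 (ev (Fin.last _))) : ℚ) /
          (2 * X.l * ((placeOf X pp.1 (ev (Fin.last _))).asIdeal.ramificationIdx ℤ : ℚ))) := by
  have hϖ : ∀ a, IsUniformizer (unifChoice (kOf X pp.1 (ev a))) := fun a => isUniformizer_unifChoice _
  have hc : ∀ a, IsInnerConductor (kOf X pp.1 (ev a)) (unifChoice (kOf X pp.1 (ev a)))
      ((placeOf X pp.1 (ev a)).asIdeal.ramificationIdx ℤ / ((pp : ℕ) - 1) + 1) := fun a => by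
    have he := absRamificationIdx_kOf X pp (ev a)
    have h1 := isInnerConductor_of_not_dvd (pp : ℕ) (hϖ a) (by rw [he]; exact hnd a)
    rwa [he] at h1
  have hB : ∀ a, IsOuterOrder (kOf X pp.1 (ev a)) (unifChoice (kOf X pp.1 (ev a)))
      (((pp : ℕ) : ℤ) ^ (a₀ a) - ((placeOf X pp.1 (ev a)).asIdeal.ramificationIdx ℤ : ℤ) * (a₀ a : ℤ)) := fun a => by
    have he := absRamificationIdx_kOf X pp (ev a)
    have h1 := isOuterOrder_envelope (pp : ℕ) (hϖ a) (a₀ := a₀ a) (by rw [he]; exact hlo a) (by rw [he]; exact hhi a)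
    rwa [he] at h1
  exact cellReachMixAt_iff_of_certs X pp i ev hϖ hc hB

/-- A failed mixed cell on a summand whose LAST slot is bad refutes `HStarReachMix` at the datum. [folklore] -/
theorem not_hStarReachMix_of_not_cellReachMixAt (pp : Nat.Primes) [Fact (pp : ℕ).Prime] (i : Fin X.lstar)
    (ev : (thetaIndex X).Caps (Setting.labelSucc i) → (thetaIndex X).Fibre (.inr pp))
    (hx : placeOf X pp.1 (ev (Fin.last _)) ∈ X.S) (hneg : ¬ CellReachMixAt X pp i ev) : ¬ HStarReachMix X :=
  fun h => hneg (h pp i ev hx)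

end Candidate

/-! ## §C3. Σ₂₀^mix decided at the genuine bed `Cor312Prov.pilotDataOfK D K` (all slots untied) -/

section Genuine

open Thm311 Thm311.Real Cor312 Cor312.Setting Cor312Vol Cor312Prov Literature.IUT.HodgeTheaters
  Summit.ABC.IUTFork.Repair.RH.ShellCapacityPlus

variable {F K Fbar : Type} [Field F] [NumberField F] [Field K] [NumberField K] [Algebra F K] [Field Fbar]
  [Algebra F Fbar] [Algebra K Fbar] {E : WeierstrassCurve F} [E.IsElliptic] {l : ℕ} {Pb : BadPlacePredicates K}
  (D : InitialThetaData F K Fbar E l Pb)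

/-- **Σ₂₀^mix AS RATIONAL CELLS AT THE GENUINE BED (all slots untied)**: for a summand `ev` of the packet `(i+1, p)` of `pilotDataOfK D K` whose last slot
`x = ev(last)` is a bad place of `K` over `v ∈ 𝕍(F)^bad`, with `(p−1) ∤ e_a` and a strict turning point `a₀ a` at EVERY slot, the mixed cell holds IFF
the rational column cell holds with `α_a = (r_in_ub(e_a) − 1)/e_a`, `β_a = r_out_sharp(e_a)/e_a`, `μ = e(x|v)·ord_v(q_v)/(2l·e_x)`
(`ord_x(q) = e(x|v)·ord_v(q_v)`, `Cor312Prov.ordq_pilotDataOfK`). This is the statement abc-iut-rh2-q3-num's Q3-SIGMA20MIX and abc-iut-rh-kit-1's PASS 13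
evaluate, tuple by tuple. [cite: Mochizuki2012, IUTchI Def. 3.1 (c) p. 61] [cite: NeukirchANT1999, Ch. II (5.5)] [claim: Mochizuki2012, status: disputed] -/
theorem cellReachMixAt_pilotDataOfK_iff_col_of_not_dvd (pp : Nat.Primes) [Fact (pp : ℕ).Prime] (i : Fin (pilotDataOfK D K).lstar)
    (ev : (thetaIndex (pilotDataOfK D K)).Caps (Setting.labelSucc i) → (thetaIndex (pilotDataOfK D K)).Fibre (.inr pp))
    (hx : placeOf (pilotDataOfK D K) pp.1 (ev (Fin.last _)) ∈ (pilotDataOfK D K).S)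
    (hnd : ∀ a, ¬ ((pp : ℕ) - 1 ∣ (placeOf (pilotDataOfK D K) pp.1 (ev a)).asIdeal.ramificationIdx ℤ))
    {a₀ : (thetaIndex (pilotDataOfK D K)).Caps (Setting.labelSucc i) → ℕ}
    (hlo : ∀ a, ∀ t < a₀ a, ((pp : ℕ) : ℤ) ^ t * (((pp : ℕ) : ℤ) - 1) < (placeOf (pilotDataOfK D K) pp.1 (ev a)).asIdeal.ramificationIdx ℤ)
    (hhi : ∀ a, ((placeOf (pilotDataOfK D K) pp.1 (ev a)).asIdeal.ramificationIdx ℤ : ℤ) < ((pp : ℕ) : ℤ) ^ (a₀ a) * (((pp : ℕ) : ℤ) - 1)) :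
    CellReachMixAt (pilotDataOfK D K) pp i ev ↔
      MixedReachCell
        (fun a => ((((placeOf (pilotDataOfK D K) pp.1 (ev a)).asIdeal.ramificationIdx ℤ / ((pp : ℕ) - 1) + 1 : ℕ) : ℚ) - 1) /
          ((placeOf (pilotDataOfK D K) pp.1 (ev a)).asIdeal.ramificationIdx ℤ : ℚ))
        (fun a => ((((pp : ℕ) : ℤ) ^ (a₀ a) - ((placeOf (pilotDataOfK D K) pp.1 (ev a)).asIdeal.ramificationIdx ℤ : ℤ) * (a₀ a : ℤ) : ℤ) : ℚ) /
          ((placeOf (pilotDataOfK D K) pp.1 (ev a)).asIdeal.ramificationIdx ℤ : ℚ)) ((i : ℕ) + 1)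
        (((((finBelow F K (placeOf (pilotDataOfK D K) pp.1 (ev (Fin.last _)))).asIdeal.ramificationIdx'
              (placeOf (pilotDataOfK D K) pp.1 (ev (Fin.last _))).asIdeal : ℤ) *
            (qParamOrd E (finBelow F K (placeOf (pilotDataOfK D K) pp.1 (ev (Fin.last _)))) : ℤ) : ℤ) : ℚ) /
          (2 * l * ((placeOf (pilotDataOfK D K) pp.1 (ev (Fin.last _))).asIdeal.ramificationIdx ℤ : ℚ))) := by
  rw [cellReachMixAt_iff_col_of_not_dvd (pilotDataOfK D K) pp i ev hnd hlo hhi, ordq_pilotDataOfK D K hx, pilotDataOfK_l]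

/-- **… and a column-NEG summand (last slot bad) at the genuine datum refutes `HStarReachMix` there** (every `p`, every slot type; ties included) — the data
OUTSIDE Σ₂₀^mix. [cite: Mochizuki2012, IUTchI Def. 3.1 (c) p. 61] [claim: Mochizuki2012, status: disputed] -/
theorem not_hStarReachMix_pilotDataOfK_of_not_col (pp : Nat.Primes) [Fact (pp : ℕ).Prime] (i : Fin (pilotDataOfK D K).lstar)
    (ev : (thetaIndex (pilotDataOfK D K)).Caps (Setting.labelSucc i) → (thetaIndex (pilotDataOfK D K)).Fibre (.inr pp))
    (hx : placeOf (pilotDataOfK D K) pp.1 (ev (Fin.last _)) ∈ (pilotDataOfK D K).S)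
    {a₀ : (thetaIndex (pilotDataOfK D K)).Caps (Setting.labelSucc i) → ℕ}
    (hlo : ∀ a, ∀ t < a₀ a, ((pp : ℕ) : ℤ) ^ t * (((pp : ℕ) : ℤ) - 1) < (placeOf (pilotDataOfK D K) pp.1 (ev a)).asIdeal.ramificationIdx ℤ)
    (hhi : ∀ a, ((placeOf (pilotDataOfK D K) pp.1 (ev a)).asIdeal.ramificationIdx ℤ : ℤ) ≤ ((pp : ℕ) : ℤ) ^ (a₀ a) * (((pp : ℕ) : ℤ) - 1))
    (hneg : ¬ MixedReachCell
        (fun a => ((((placeOf (pilotDataOfK D K) pp.1 (ev a)).asIdeal.ramificationIdx ℤ / ((pp : ℕ) - 1) + 1 : ℕ) : ℚ) - 1) /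
          ((placeOf (pilotDataOfK D K) pp.1 (ev a)).asIdeal.ramificationIdx ℤ : ℚ))
        (fun a => ((((pp : ℕ) : ℤ) ^ (a₀ a) - ((placeOf (pilotDataOfK D K) pp.1 (ev a)).asIdeal.ramificationIdx ℤ : ℤ) * (a₀ a : ℤ) : ℤ) : ℚ) /
          ((placeOf (pilotDataOfK D K) pp.1 (ev a)).asIdeal.ramificationIdx ℤ : ℚ)) ((i : ℕ) + 1)
        (((((finBelow F K (placeOf (pilotDataOfK D K) pp.1 (ev (Fin.last _)))).asIdeal.ramificationIdx'
              (placeOf (pilotDataOfK D K) pp.1 (ev (Fin.last _))).asIdeal : ℤ) *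
            (qParamOrd E (finBelow F K (placeOf (pilotDataOfK D K) pp.1 (ev (Fin.last _)))) : ℤ) : ℤ) : ℚ) /
          (2 * l * ((placeOf (pilotDataOfK D K) pp.1 (ev (Fin.last _))).asIdeal.ramificationIdx ℤ : ℚ)))) :
    ¬ HStarReachMix (pilotDataOfK D K) := by
  refine not_hStarReachMix_of_not_cellReachMixAt (pilotDataOfK D K) pp i ev hx
    (not_cellReachMixAt_of_not_col (pilotDataOfK D K) pp i ev hlo hhi ?_)
  rwa [ordq_pilotDataOfK D K hx, pilotDataOfK_l]

end Genuine

end Summit.ABC.IUTFork.Repair.RH.LinearReachLaw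

end
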